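/-
Copyright (c) 2026 the pub-hodgecm-mathlib formalisation cell (harness21).  Prover seat hodgecm-mathlib-F0P2-p09 (g3) on chair-VALVE loan to section S6 of the R90-TF
programme (S6 dealer R90-C14-plan (g2) «take §3» 2026-09-05T02:31:48Z; chair K2-lead (g2) VALVE 19); crux H413 (`stmt-HodgeConjecture-24833`).
THEOREMS ONLY (no `def`, no `instance`, no notation, no named-fact hypothesis, no `sorry`).
-/
import Summits.HodgeConjecture.HodgeConjecture.Theorems.R90S6FlickerLiteralRegimes                    -- ★ (m2) regime letters `flickerLiteral_*`
import Literature.NumberTheory.Rogawski1990.UnitFundamentalLemmaInertFlickerTorus                      -- ★ Flicker's literals and frames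
import Literature.NumberTheory.Automorphic.UnitaryGroupRankOneBigCell                                  -- ★ `inv_apply_of_mem`, `coe_coe_weylLongU_three`
import Literature.NumberTheory.Automorphic.FixedCosetsStableLattices                                   -- ★ `mem_fixedBy_quotient_mk_iff`
import Literature.NumberTheory.Automorphic.UnitaryFixedCosetsStableLattices                            -- ★ `unitaryInt_eq_glInt_subgroupOf`
import Literature.NumberTheory.Automorphic.FixedCosetsModularLatticesSep                               -- ★ `mem_map_conj_glInt_iff`
import Literature.NumberTheory.Automorphic.ProjectiveDescentLatticeLevelsDischarge                     -- ★ `mem_glInt_iff_forall_v_le_one_of_v_det_eq_one`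
import HarnessLib

/-!
# R90 · S6 — §3 of CARD (m2), FILE A: THE LITERAL-DEPENDENT FRAME ∕ FIX LETTERS OF FLICKER'S `t₁ = t_1(a,b,c)` VERSUS `t_ϖ(a,b,c)`
# (`Theorems/R90S6FlickerLiteralFrames.lean`)

Cell `hodgecm-mathlib`, crux H413 (`stmt-HodgeConjecture-24833`), route of record `HCCMUnconditional`; programme R90-TF, section S6 (base `R90-C14`); S6 dealer
R90-C14-plan (g2) «take §3» 02:31:48Z; consumer GF1 FILE 2 (K2Liu-p14 (g5)): the per-literal fixed-vertex counts `(V_hyp, V_sp)(tᵢ)`; helper lane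
`--supports stmt-HodgeConjecture-24833 --as helper`.

THE QUESTION.  ★ (m2) `R90S6FlickerLiteralRegimes` shows the four literals `t₁ = t_1(a,b,c)`, `t₂ = t_ϖ(a,b,c)`, `t₃ = t_ϖ(a,c,b)`, `t₄ = t_ϖ(b,a,c)` of typ1's (E1) sheet have
the SAME regime letters (all four have `charpoly = (X − a)(X − b)(X − c)`, ★ `charpoly_flickerTorusElt`).  What distinguishes them is FRAME ∕ FIX data: ★ CountsRegular
`natCard_fixedBy_eq_of_residually_regular` (`R90S6TorusFixedCountsRegular` :48–:57) asks for `k ∈ unitaryInt` (`hk`), an integral frame `P` with integral inverse (`hP`, `hP'`),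
`k·P = P·diag u` (`hkP`), separated `u` (`hreg`) and residually ANISOTROPIC eigencolumns `hanis : ∀ i, |B₀ σ 3 (P eᵢ) (P eᵢ)| = 1`.
* §1 `t₁` (`θ = 1`, residue characteristic `≠ 2`: `|2| = 1`, `2e = 1`): Flicker's frame `P₁ = !![1,0,1;0,1,0;−1,0,1]` (★ `flickerTorusElt_one_mul_frame`, `det P₁ = 2`) meets EVERY
  CountsRegular binder (pure plumbing is `private`, 15 public letters): `flickerFrame_one_integral` (`hP`), `flickerFrame_one_inv_eq` ∕ `flickerFrame_one_inv_integral` (`P₁⁻¹ = !![e,0,−e;0,1,0;e,0,e]`, `hP'`),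
  `flickerFrame_one_mul_eq` (`hkP` at `u = ![a,b,c]`), `flickerFrame_one_B₀` ∕ **`flickerFrame_one_anis`** (the eigencolumn lengths are `(−2, 1, 2)` — units iff `|2| = 1`: `hanis`),
  `flickerFrame_one_mem_unitaryInt` (`hk`), `flickerFrame_exists_gl_one`; `hreg` at `![a,b,c]` is ★ `flickerLiteral_separated_letters_iff`.
* §2 `t_ϖ`: the frame `P_ϖ = diag(ϖ,1,1)·P₁ = !![ϖ,0,ϖ;0,1,0;−1,0,1]` still has `hkP` (`flickerFrame_pi_mul_eq`) and `hP` (`flickerFrame_pi_integral`) but **FAILS `hP'`**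
  (`flickerFrame_pi_inv_eq`: `P_ϖ⁻¹ = !![e ϖ⁻¹, 0, −e; 0,1,0; e ϖ⁻¹, 0, e]`, `flickerFrame_pi_one_lt_v_inv`) **and FAILS `hanis`**: the lengths are `(−2ϖ, 1, 2ϖ)` (`flickerFrame_pi_B₀`,
  `flickerFrame_pi_v_B₀`, **`flickerFrame_pi_not_anis`**) — the `a`- and `c`-eigenlines are ODD (Flicker's sign vector `(1,0,1)`, ★ `normTest_flickerFrame_pi_iff`); and `hk` holds iff
  `n_ac ≥ 1` (**`flickerFrame_pi_mem_unitaryInt_iff`**: `t_ϖ(a,b,c) ∈ K₀ ↔ |a − c| ≤ |ϖ|`, the `(2,0)` entry being `−e(a−c)ϖ⁻¹`).  WHAT REPLACES `hanis`: `t_ϖ = diag(ϖ,1,1)·t₁·diag(ϖ,1,1)⁻¹`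
  (★ `diag_mul_flickerTorusElt_one`) stabilises the SPECIAL vertex `diag(ϖ,1,1)·L₀ = w₀·(g₁·L₀)` (`w₀ = antidiag(1,1,1) ∈ U`, `g₁ = diag(1,1,ϖ)`): the matrix identity
  `flickerFrame_gOne_weyl_conj_pi` (`diag(1,1,ϖ)⁻¹·(w₀ t_ϖ w₀)·diag(1,1,ϖ) = t₁`) gives the **FIX LETTERS** `flickerFrame_weyl_mem_fixedBy` (`↑w₀ ∈ Fix_{t_ϖ}(U ⧸ K₁)`,
  `K₁ = (GL₃(𝒪).map (conj g₁)) ⊓ U`) and `flickerFrame_one_mem_fixedBy` (`1 ∈ Fix_{t₁}(U ⧸ K₀)`), `flickerFrame_exists_weyl` (`w₀` exists: ★ `weylLongU`).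
* The COUNTS in regime R-III (`(V_hyp, V_sp)(t₁) = (1, 0)`, `(V_hyp, V_sp)(t_ϖ) = (0, 1)` over the ★ R-III rung `a₁ + a₀ = 1` and these Fix letters) are the sibling file
  `Theorems/R90S6FlickerLiteralCounts.lean` (the 400-line rule).
[Flicker1998UnitaryFL, §2 Prop. 3 pp. 78–79; §3 p. 80] [Rogawski1990, §3.5 Prop. 3.5.2 p. 26, §4.9 pp. 54–56] [Kottwitz1986BaseChangeUnits, §1 pp. 240–242] [Serre1980Trees, I.6.1, II.1.1].
HONEST LABEL: frame ∕ Fix bookkeeping of explicit literals over ★ organs; pays no rung and no printed statement by itself; count-neutral.  HC_CM is proved only modulo the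
7 printed citations (2 remaining named inputs: hLiu418 = `stmt-HodgeConjecture-24832`, h413 = `stmt-HodgeConjecture-24833`) until rung 0 closes.

## References
* [Flicker1998UnitaryFL] Y. Z. Flicker, *Elementary proof of the fundamental lemma for a unitary group*, Canad. J. Math. 50 (1998) 74–98: §2 Prop. 3 pp. 78–79 (`t₁…t₄`, frames, sign vectors), §3 p. 80.
* [Rogawski1990] J. D. Rogawski, *Automorphic Representations of Unitary Groups in Three Variables*, Ann. of Math. Stud. 123 (1990): §3.5 Prop. 3.5.2 pp. 25–26 (lengths ∕ sign vectors of eigenframes), §4.9 pp. 54–56.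
* [Kottwitz1986BaseChangeUnits] R. E. Kottwitz, *Base change for unit elements of Hecke algebras*, Compositio Math. 60 (1986) 237–250: §1 pp. 240–242.
* [Serre1980Trees] J.-P. Serre, *Trees* (1980): I.6.1, II.1.1 (vertices of the building as lattice classes; fixed points).
-/

set_option autoImplicit false
-- the mandated namespace repeats the single-problem summit's segment (`HodgeConjecture.HodgeConjecture`)
set_option linter.dupNamespace false

noncomputable section

open MulAction Polynomial
open Literature.NumberTheory.Automorphic Literature.NumberTheory.Automorphic.HermitianLattice Literature.NumberTheory.Automorphic.UnitaryGroup
open Literature.NumberTheory.Automorphic.UnitaryLatticeTree Literature.NumberTheory.Rogawski1990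
open scoped Matrix MatrixGroups WithZero Valued

namespace Summit.HodgeConjecture.HodgeConjecture.R90.S6

variable {K : Type*} [Field K] [Valued K ℤᵐ⁰]

/-! ## §0 Valuation helpers -/

/-- `|e| = 1` for `e = ½` in residue characteristic `≠ 2`. [cite: Flicker1998UnitaryFL, §2 Prop. 3 p. 78] -/
theorem flickerFrame_v_half {e : K} (h2 : Valued.v (2 : K) = 1) (h2e : 2 * e = 1) : Valued.v e = 1 := by
  have h := congrArg Valued.v h2e
  rw [map_mul, h2, one_mul, map_one] at h
  exact h

/-- `|e (x ± y)|`-type bound: `|e| ≤ 1`, `|x| ≤ 1`, `|y| ≤ 1` give `|e (x + y)| ≤ 1`. [folklore] -/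
private theorem flickerFrame_v_mul_add_le_one {e x y : K} (he : Valued.v e ≤ 1) (hx : Valued.v x ≤ 1) (hy : Valued.v y ≤ 1) : Valued.v (e * (x + y)) ≤ 1 := by
  rw [map_mul]
  exact mul_le_one' he (le_trans (Valuation.map_add _ _ _) (max_le hx hy))

/-- … and `|e (x − y)| ≤ 1`. [folklore] -/
private theorem flickerFrame_v_mul_sub_le_one {e x y : K} (he : Valued.v e ≤ 1) (hx : Valued.v x ≤ 1) (hy : Valued.v y ≤ 1) : Valued.v (e * (x - y)) ≤ 1 := by
  rw [map_mul]
  exact mul_le_one' he (le_trans (Valuation.map_sub _ _ _) (max_le hx hy))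

/-- `rev` on `Fin 3`. [folklore] -/
private theorem flickerFrame_rev_three : (0 : Fin 3).rev = 2 ∧ (1 : Fin 3).rev = 1 ∧ (2 : Fin 3).rev = 0 := by decide

/-! ## §1 The literal `t₁ = t_1(a,b,c)`: Flicker's frame `P₁` meets every CountsRegular binder -/

omit [Valued K ℤᵐ⁰] in
/-- `P₁ = !![1,0,1;0,1,0;−1,0,1]` is invertible when `2 ≠ 0` (`det P₁ = 2`, ★ `det_flickerFrame`). [cite: Flicker1998UnitaryFL, §2 Prop. 3 p. 79] -/
theorem flickerFrame_exists_gl_one (h2 : (2 : K) ≠ 0) :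
    ∃ P : GL (Fin 3) K, (P : Matrix (Fin 3) (Fin 3) K) = !![(1 : K), 0, 1; 0, 1, 0; -1, 0, 1] := by
  refine ⟨Matrix.GeneralLinearGroup.mkOfDetNeZero _ ?_, rfl⟩
  rw [det_flickerFrame, mul_one]
  exact h2

/-- `hP` for `P₁`: its entries `0, ±1` are integral. [cite: Flicker1998UnitaryFL, §2 Prop. 3 p. 79] -/
private theorem flickerFrame_one_integral (P : GL (Fin 3) K) (hP₁ : (P : Matrix (Fin 3) (Fin 3) K) = !![(1 : K), 0, 1; 0, 1, 0; -1, 0, 1]) (i j : Fin 3) :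
    Valued.v ((P : Matrix (Fin 3) (Fin 3) K) i j) ≤ 1 := by
  rw [hP₁]
  fin_cases i <;> fin_cases j <;> simp

omit [Valued K ℤᵐ⁰] in
/-- `P₁⁻¹ = !![e,0,−e;0,1,0;e,0,e]` (`2e = 1`). [cite: Flicker1998UnitaryFL, §2 Prop. 3 p. 79] -/
private theorem flickerFrame_one_inv_eq {e : K} (h2e : 2 * e = 1) (P : GL (Fin 3) K) (hP₁ : (P : Matrix (Fin 3) (Fin 3) K) = !![(1 : K), 0, 1; 0, 1, 0; -1, 0, 1]) :
    ((P⁻¹ : GL (Fin 3) K) : Matrix (Fin 3) (Fin 3) K) = !![e, 0, -e; 0, 1, 0; e, 0, e] := by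
  rw [Matrix.coe_units_inv, hP₁]
  refine Matrix.inv_eq_right_inv ?_
  ext i j
  fin_cases i <;> fin_cases j <;> simp [Matrix.mul_apply, Fin.sum_univ_three] <;> grind

/-- `hP'` for `P₁`: the entries `0, 1, ±e` of `P₁⁻¹` are integral (`|2| = 1`). [cite: Flicker1998UnitaryFL, §2 Prop. 3 p. 79] -/
private theorem flickerFrame_one_inv_integral {e : K} (h2 : Valued.v (2 : K) = 1) (h2e : 2 * e = 1) (P : GL (Fin 3) K)
    (hP₁ : (P : Matrix (Fin 3) (Fin 3) K) = !![(1 : K), 0, 1; 0, 1, 0; -1, 0, 1]) (i j : Fin 3) :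
    Valued.v (((P⁻¹ : GL (Fin 3) K) : Matrix (Fin 3) (Fin 3) K) i j) ≤ 1 := by
  have he := flickerFrame_v_half h2 h2e
  rw [flickerFrame_one_inv_eq h2e P hP₁]
  fin_cases i <;> fin_cases j <;> simp [he.le]

omit [Valued K ℤᵐ⁰] in
/-- `hkP` for `t₁` and `P₁` at `u = ![a, b, c]` (★ `flickerTorusElt_one_mul_frame`). [cite: Flicker1998UnitaryFL, §2 Prop. 3 pp. 78–79] -/
theorem flickerFrame_one_mul_eq {σ : K →+* K} {e a b c : K} (h2e : 2 * e = 1) (γ : ↥(unitaryGroupOfForm σ ((StdForm.antidiagonal 3).over K)))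
    (hγ : ((γ : GL (Fin 3) K) : Matrix (Fin 3) (Fin 3) K) = !![e * (a + c), 0, -(e * (a - c)); 0, b, 0; -(e * (a - c)), 0, e * (a + c)])
    (P : GL (Fin 3) K) (hP₁ : (P : Matrix (Fin 3) (Fin 3) K) = !![(1 : K), 0, 1; 0, 1, 0; -1, 0, 1]) :
    ((γ : GL (Fin 3) K) : Matrix (Fin 3) (Fin 3) K) * (P : Matrix (Fin 3) (Fin 3) K) = (P : Matrix (Fin 3) (Fin 3) K) * Matrix.diagonal ![a, b, c] := by
  rw [hγ, hP₁, flickerTorusElt_one_mul_frame h2e, etaDiag_eq_diagonal]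

omit [Valued K ℤᵐ⁰] in
/-- THE EIGENCOLUMN LENGTHS of `P₁`: `B₀ (P₁ eᵢ) (P₁ eᵢ) = (−2, 1, 2)ᵢ` (★ `twistGram_flickerFrame` at `θ = 1`, in `B₀` currency). [cite: Flicker1998UnitaryFL, §2 Prop. 3 p. 79]
[cite: Rogawski1990, §3.5 Prop. 3.5.2 p. 26] -/
theorem flickerFrame_one_B₀ (σ : K →+* K) (P : GL (Fin 3) K) (hP₁ : (P : Matrix (Fin 3) (Fin 3) K) = !![(1 : K), 0, 1; 0, 1, 0; -1, 0, 1]) (i : Fin 3) :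
    B₀ σ 3 ((P : Matrix (Fin 3) (Fin 3) K).mulVec (Pi.single i 1)) ((P : Matrix (Fin 3) (Fin 3) K).mulVec (Pi.single i 1)) = ![-2, 1, 2] i := by
  obtain ⟨h0, h1, h2⟩ := flickerFrame_rev_three
  rw [hP₁, Matrix.mulVec_single_one, B₀_apply, Fin.sum_univ_three, h0, h1, h2]
  fin_cases i <;> simp <;> ring

/-- **`hanis` for `t₁`**: the eigencolumns of `P₁` are residually anisotropic iff `|2| = 1`. [cite: Flicker1998UnitaryFL, §2 Prop. 3 p. 79] [cite: Rogawski1990, §3.5 Prop. 3.5.2 p. 26] -/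
theorem flickerFrame_one_anis (σ : K →+* K) (h2 : Valued.v (2 : K) = 1) (P : GL (Fin 3) K)
    (hP₁ : (P : Matrix (Fin 3) (Fin 3) K) = !![(1 : K), 0, 1; 0, 1, 0; -1, 0, 1]) (i : Fin 3) :
    Valued.v (B₀ σ 3 ((P : Matrix (Fin 3) (Fin 3) K).mulVec (Pi.single i 1)) ((P : Matrix (Fin 3) (Fin 3) K).mulVec (Pi.single i 1))) = 1 := by
  rw [flickerFrame_one_B₀ σ P hP₁ i]
  fin_cases i <;> simp [h2]

/-- The entries of `t₁(a,b,c)` are integral for norm-one `a, b, c` and `|2| = 1`. [cite: Flicker1998UnitaryFL, §2 Prop. 3 p. 78] -/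
private theorem flickerFrame_one_entries_integral {σ : K →+* K} (hvσ : ∀ x, Valued.v (σ x) = Valued.v x) {e a b c : K} (h2 : Valued.v (2 : K) = 1) (h2e : 2 * e = 1)
    (ha : σ a * a = 1) (hb : σ b * b = 1) (hc : σ c * c = 1) (i j : Fin 3) :
    Valued.v ((!![e * (a + c), 0, -(e * (a - c)); 0, b, 0; -(e * (a - c)), 0, e * (a + c)] : Matrix (Fin 3) (Fin 3) K) i j) ≤ 1 := by
  have he := (flickerFrame_v_half h2 h2e).le
  have ha1 := (flickerLiteral_norm_one_letters σ hvσ ha).2.le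
  have hb1 := (flickerLiteral_norm_one_letters σ hvσ hb).2.le
  have hc1 := (flickerLiteral_norm_one_letters σ hvσ hc).2.le
  have hp : Valued.v e * Valued.v (a + c) ≤ 1 := by rw [← map_mul]; exact flickerFrame_v_mul_add_le_one he ha1 hc1
  have hm : Valued.v e * Valued.v (a - c) ≤ 1 := by rw [← map_mul]; exact flickerFrame_v_mul_sub_le_one he ha1 hc1
  fin_cases i <;> fin_cases j <;> simp [hp, hm, hb1]

/-- **`hk` for `t₁`**: `t₁(a,b,c) ∈ K₀ = U ∩ GL₃(𝒪)` (entries integral; the inverse of a unitary element is `Φ₃ ᵗσ(·) Φ₃`, ★ `inv_apply_of_mem`).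
[cite: Flicker1998UnitaryFL, §2 Prop. 3 p. 78] [cite: Rogawski1990, §4.9 p. 54] -/
theorem flickerFrame_one_mem_unitaryInt {σ : K →+* K} (hvσ : ∀ x, Valued.v (σ x) = Valued.v x) {e a b c : K} (h2 : Valued.v (2 : K) = 1) (h2e : 2 * e = 1)
    (ha : σ a * a = 1) (hb : σ b * b = 1) (hc : σ c * c = 1) (γ : ↥(unitaryGroupOfForm σ ((StdForm.antidiagonal 3).over K)))
    (hγ : ((γ : GL (Fin 3) K) : Matrix (Fin 3) (Fin 3) K) = !![e * (a + c), 0, -(e * (a - c)); 0, b, 0; -(e * (a - c)), 0, e * (a + c)]) :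
    γ ∈ unitaryInt σ ((StdForm.antidiagonal 3).over K) := by
  rw [mem_unitaryInt_iff]
  have hint : ∀ i j, Valued.v (((γ : GL (Fin 3) K) : Matrix (Fin 3) (Fin 3) K) i j) ≤ 1 := by
    intro i j; rw [hγ]; exact flickerFrame_one_entries_integral hvσ h2 h2e ha hb hc i j
  refine ⟨hint, fun i j => ?_⟩
  rw [inv_apply_of_mem σ rfl γ i j, hvσ]
  exact hint _ _

/-! ## §2 The literal `t_ϖ(a,b,c)`: `hkP`, `hP` survive; `hP'`, `hanis` and (in regime R-III) `hk` FAIL; the Fix letter that replaces them -/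

omit [Valued K ℤᵐ⁰] in
/-- `hkP` for `t_ϖ` and `P_ϖ = !![ϖ,0,ϖ;0,1,0;−1,0,1]` at `u = ![a,b,c]` (★ `flickerTorusElt_mul_frame`, `θ = ϖ`, `θ' = ϖ⁻¹`). [cite: Flicker1998UnitaryFL, §3 p. 80] -/
theorem flickerFrame_pi_mul_eq {σ : K →+* K} {ϖ e a b c : K} (h2e : 2 * e = 1) (hϖ0 : ϖ ≠ 0) (γ : ↥(unitaryGroupOfForm σ ((StdForm.antidiagonal 3).over K)))
    (hγ : ((γ : GL (Fin 3) K) : Matrix (Fin 3) (Fin 3) K) = !![e * (a + c), 0, -(e * (a - c) * ϖ); 0, b, 0; -(e * (a - c) * ϖ⁻¹), 0, e * (a + c)])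
    (P : GL (Fin 3) K) (hPϖ : (P : Matrix (Fin 3) (Fin 3) K) = !![ϖ, 0, ϖ; 0, 1, 0; -1, 0, 1]) :
    ((γ : GL (Fin 3) K) : Matrix (Fin 3) (Fin 3) K) * (P : Matrix (Fin 3) (Fin 3) K) = (P : Matrix (Fin 3) (Fin 3) K) * Matrix.diagonal ![a, b, c] := by
  rw [hγ, hPϖ, flickerTorusElt_mul_frame h2e (mul_inv_cancel₀ hϖ0), etaDiag_eq_diagonal]

/-- `hP` for `P_ϖ`: entries `0, ±1, ϖ` integral. [cite: Flicker1998UnitaryFL, §3 p. 80] -/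
private theorem flickerFrame_pi_integral {ϖ : K} (hϖ1 : Valued.v ϖ ≤ 1) (P : GL (Fin 3) K) (hPϖ : (P : Matrix (Fin 3) (Fin 3) K) = !![ϖ, 0, ϖ; 0, 1, 0; -1, 0, 1])
    (i j : Fin 3) : Valued.v ((P : Matrix (Fin 3) (Fin 3) K) i j) ≤ 1 := by
  rw [hPϖ]
  fin_cases i <;> fin_cases j <;> simp [hϖ1]

omit [Valued K ℤᵐ⁰] in
/-- `P_ϖ⁻¹ = !![e ϖ⁻¹, 0, −e; 0, 1, 0; e ϖ⁻¹, 0, e]`. [cite: Flicker1998UnitaryFL, §3 p. 80] -/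
private theorem flickerFrame_pi_inv_eq {ϖ e : K} (h2e : 2 * e = 1) (hϖ0 : ϖ ≠ 0) (P : GL (Fin 3) K) (hPϖ : (P : Matrix (Fin 3) (Fin 3) K) = !![ϖ, 0, ϖ; 0, 1, 0; -1, 0, 1]) :
    ((P⁻¹ : GL (Fin 3) K) : Matrix (Fin 3) (Fin 3) K) = !![e * ϖ⁻¹, 0, -e; 0, 1, 0; e * ϖ⁻¹, 0, e] := by
  rw [Matrix.coe_units_inv, hPϖ]
  refine Matrix.inv_eq_right_inv ?_
  ext i j
  fin_cases i <;> fin_cases j <;> simp [Matrix.mul_apply, Fin.sum_univ_three] <;> field_simp <;> grind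

/-- **`hP'` FAILS for `P_ϖ`**: the `(0,0)` entry `e ϖ⁻¹` of `P_ϖ⁻¹` has valuation `|ϖ|⁻¹ > 1`. [cite: Flicker1998UnitaryFL, §3 p. 80] -/
theorem flickerFrame_pi_one_lt_v_inv {ϖ e : K} (h2 : Valued.v (2 : K) = 1) (h2e : 2 * e = 1) (hϖ0 : ϖ ≠ 0) (hϖ : Valued.v ϖ < 1) (P : GL (Fin 3) K)
    (hPϖ : (P : Matrix (Fin 3) (Fin 3) K) = !![ϖ, 0, ϖ; 0, 1, 0; -1, 0, 1]) :
    1 < Valued.v (((P⁻¹ : GL (Fin 3) K) : Matrix (Fin 3) (Fin 3) K) 0 0) := by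
  have he := flickerFrame_v_half h2 h2e
  rw [flickerFrame_pi_inv_eq h2e hϖ0 P hPϖ]
  simp only [Matrix.of_apply, Matrix.cons_val', Matrix.cons_val_zero, Matrix.cons_val_fin_one, map_mul, map_inv₀, he, one_mul]
  exact one_lt_inv_iff₀.2 ⟨(Valuation.pos_iff _).2 hϖ0, hϖ⟩

omit [Valued K ℤᵐ⁰] in
/-- THE EIGENCOLUMN LENGTHS of `P_ϖ`: `B₀ (P_ϖ eᵢ) (P_ϖ eᵢ) = (−2ϖ, 1, 2ϖ)ᵢ` (`σϖ = ϖ`; ★ `twistGram_flickerFrame` in `B₀` currency).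
[cite: Flicker1998UnitaryFL, §2 Prop. 3 p. 79; §3 p. 80] [cite: Rogawski1990, §3.5 Prop. 3.5.2 p. 26] -/
theorem flickerFrame_pi_B₀ {σ : K →+* K} {ϖ : K} (hσϖ : σ ϖ = ϖ) (P : GL (Fin 3) K) (hPϖ : (P : Matrix (Fin 3) (Fin 3) K) = !![ϖ, 0, ϖ; 0, 1, 0; -1, 0, 1])
    (i : Fin 3) :
    B₀ σ 3 ((P : Matrix (Fin 3) (Fin 3) K).mulVec (Pi.single i 1)) ((P : Matrix (Fin 3) (Fin 3) K).mulVec (Pi.single i 1)) = ![-(2 * ϖ), 1, 2 * ϖ] i := by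
  obtain ⟨h0, h1, h2⟩ := flickerFrame_rev_three
  rw [hPϖ, Matrix.mulVec_single_one, B₀_apply, Fin.sum_univ_three, h0, h1, h2]
  fin_cases i <;> simp [hσϖ] <;> ring

/-- Their valuations: `(|ϖ|, 1, |ϖ|)` (`|2| = 1`). [cite: Flicker1998UnitaryFL, §3 p. 80] [cite: Rogawski1990, §3.5 Prop. 3.5.2 p. 26] -/
theorem flickerFrame_pi_v_B₀ {σ : K →+* K} {ϖ : K} (h2 : Valued.v (2 : K) = 1) (hσϖ : σ ϖ = ϖ) (P : GL (Fin 3) K)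
    (hPϖ : (P : Matrix (Fin 3) (Fin 3) K) = !![ϖ, 0, ϖ; 0, 1, 0; -1, 0, 1]) (i : Fin 3) :
    Valued.v (B₀ σ 3 ((P : Matrix (Fin 3) (Fin 3) K).mulVec (Pi.single i 1)) ((P : Matrix (Fin 3) (Fin 3) K).mulVec (Pi.single i 1))) =
      ![Valued.v ϖ, 1, Valued.v ϖ] i := by
  rw [flickerFrame_pi_B₀ hσϖ P hPϖ i]
  fin_cases i <;> simp [h2]

/-- **`hanis` FAILS for `P_ϖ`**: the `a`-eigencolumn `(ϖ, 0, −1)` has length `−2ϖ ∈ 𝔪`. [cite: Flicker1998UnitaryFL, §2 Prop. 3 p. 79; §3 p. 80] [cite: Rogawski1990, §3.5 Prop. 3.5.2 p. 26] -/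
theorem flickerFrame_pi_not_anis {σ : K →+* K} {ϖ : K} (h2 : Valued.v (2 : K) = 1) (hσϖ : σ ϖ = ϖ) (hϖ : Valued.v ϖ < 1) (P : GL (Fin 3) K)
    (hPϖ : (P : Matrix (Fin 3) (Fin 3) K) = !![ϖ, 0, ϖ; 0, 1, 0; -1, 0, 1]) :
    ¬ ∀ i : Fin 3, Valued.v (B₀ σ 3 ((P : Matrix (Fin 3) (Fin 3) K).mulVec (Pi.single i 1)) ((P : Matrix (Fin 3) (Fin 3) K).mulVec (Pi.single i 1))) = 1 := by
  intro h
  have h0 := h 0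
  rw [flickerFrame_pi_v_B₀ h2 hσϖ P hPϖ 0] at h0
  exact absurd h0 (ne_of_lt hϖ)

/-- The entries of `t_ϖ(a,b,c)` OTHER than `(2,0)` are integral; the `(2,0)` entry is `−e(a−c)ϖ⁻¹`. Packaged: all entries are integral iff `|a − c| ≤ |ϖ|`.
[cite: Flicker1998UnitaryFL, §3 p. 80] -/
private theorem flickerFrame_pi_entries_integral_iff {σ : K →+* K} (hvσ : ∀ x, Valued.v (σ x) = Valued.v x) {ϖ e a b c : K} (h2 : Valued.v (2 : K) = 1) (h2e : 2 * e = 1)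
    (hϖ0 : ϖ ≠ 0) (hϖ1 : Valued.v ϖ ≤ 1) (ha : σ a * a = 1) (hb : σ b * b = 1) (hc : σ c * c = 1) :
    (∀ i j : Fin 3, Valued.v ((!![e * (a + c), 0, -(e * (a - c) * ϖ); 0, b, 0; -(e * (a - c) * ϖ⁻¹), 0, e * (a + c)] : Matrix (Fin 3) (Fin 3) K) i j) ≤ 1) ↔
      Valued.v (a - c) ≤ Valued.v ϖ := by
  have he := flickerFrame_v_half h2 h2e
  have ha1 := (flickerLiteral_norm_one_letters σ hvσ ha).2.le
  have hb1 := (flickerLiteral_norm_one_letters σ hvσ hb).2.le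
  have hc1 := (flickerLiteral_norm_one_letters σ hvσ hc).2.le
  have hϖpos : 0 < Valued.v ϖ := (Valuation.pos_iff _).2 hϖ0
  -- the `(2,0)` entry
  have h20 : Valued.v (-(e * (a - c) * ϖ⁻¹)) ≤ 1 ↔ Valued.v (a - c) ≤ Valued.v ϖ := by
    rw [Valuation.map_neg, map_mul, map_mul, map_inv₀, he, one_mul, mul_inv_le_iff₀ hϖpos, one_mul]
  constructor
  · intro h; exact h20.1 (h 2 0)
  · intro hac i j
    have hp : Valued.v e * Valued.v (a + c) ≤ 1 := by rw [← map_mul]; exact flickerFrame_v_mul_add_le_one he.le ha1 hc1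
    have hm : Valued.v e * Valued.v (a - c) * Valued.v ϖ ≤ 1 := by
      rw [← map_mul]; exact mul_le_one' (flickerFrame_v_mul_sub_le_one he.le ha1 hc1) hϖ1
    have hm' : Valued.v e * Valued.v (a - c) * (Valued.v ϖ)⁻¹ ≤ 1 := by
      rw [← map_inv₀, ← map_mul, ← map_mul, ← Valuation.map_neg]; exact h20.2 hac
    fin_cases i <;> fin_cases j <;> simp [hp, hm, hm', hb1]

/-- **`hk` for `t_ϖ` iff `n_ac ≥ 1`**: `t_ϖ(a,b,c) ∈ K₀ = U ∩ GL₃(𝒪) ↔ |a − c| ≤ |ϖ|` — in regime R-III (`|a − c| = 1`) the literal `t_ϖ` does NOT fix the root.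
[cite: Flicker1998UnitaryFL, §2 Prop. 3 p. 79; §3 p. 80] [cite: Rogawski1990, §4.9 p. 54] -/
theorem flickerFrame_pi_mem_unitaryInt_iff {σ : K →+* K} (hvσ : ∀ x, Valued.v (σ x) = Valued.v x) {ϖ e a b c : K} (h2 : Valued.v (2 : K) = 1) (h2e : 2 * e = 1)
    (hϖ0 : ϖ ≠ 0) (hϖ1 : Valued.v ϖ ≤ 1) (ha : σ a * a = 1) (hb : σ b * b = 1) (hc : σ c * c = 1)
    (γ : ↥(unitaryGroupOfForm σ ((StdForm.antidiagonal 3).over K)))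
    (hγ : ((γ : GL (Fin 3) K) : Matrix (Fin 3) (Fin 3) K) = !![e * (a + c), 0, -(e * (a - c) * ϖ); 0, b, 0; -(e * (a - c) * ϖ⁻¹), 0, e * (a + c)]) :
    γ ∈ unitaryInt σ ((StdForm.antidiagonal 3).over K) ↔ Valued.v (a - c) ≤ Valued.v ϖ := by
  rw [mem_unitaryInt_iff, ← flickerFrame_pi_entries_integral_iff hvσ h2 h2e hϖ0 hϖ1 ha hb hc, ← hγ]
  constructor
  · exact fun h => h.1
  · intro hint
    refine ⟨hint, fun i j => ?_⟩
    rw [inv_apply_of_mem σ rfl γ i j, hvσ]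
    exact hint _ _

omit [Valued K ℤᵐ⁰] in
/-- **THE CONJUGATION IDENTITY** `diag(1,1,ϖ⁻¹) · (w₀ · t_ϖ(a,b,c) · w₀) · diag(1,1,ϖ) = t₁(a,b,c)` (`w₀ = antidiag(1,1,1)`; `w₀ t_ϖ w₀ = t_{ϖ⁻¹}`, then ★
`diag_mul_flickerTorusElt_one`): `t_ϖ` is carried into `K₀` by `w₀·g₁`, `g₁ = diag(1,1,ϖ)`. [cite: Flicker1998UnitaryFL, §2 Prop. 3 p. 79] -/
theorem flickerFrame_gOne_weyl_conj_pi {ϖ e a b c : K} (hϖ0 : ϖ ≠ 0) :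
    Matrix.diagonal ![(1 : K), 1, ϖ⁻¹] *
        ((!![(0 : K), 0, 1; 0, 1, 0; 1, 0, 0] : Matrix (Fin 3) (Fin 3) K) *
          !![e * (a + c), 0, -(e * (a - c) * ϖ); 0, b, 0; -(e * (a - c) * ϖ⁻¹), 0, e * (a + c)] * !![(0 : K), 0, 1; 0, 1, 0; 1, 0, 0]) *
        Matrix.diagonal ![(1 : K), 1, ϖ] =
      !![e * (a + c), 0, -(e * (a - c)); 0, b, 0; -(e * (a - c)), 0, e * (a + c)] := by
  ext i j
  fin_cases i <;> fin_cases j <;> simp [Matrix.mul_apply, Matrix.diagonal] <;> field_simp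

omit [Valued K ℤᵐ⁰] in
/-- `det t₁(a,b,c) = a b c` (`2e = 1`). [cite: Flicker1998UnitaryFL, §2 Prop. 3 p. 78] -/
private theorem flickerFrame_det_one {e a b c : K} (h2e : 2 * e = 1) :
    Matrix.det (!![e * (a + c), 0, -(e * (a - c)); 0, b, 0; -(e * (a - c)), 0, e * (a + c)] : Matrix (Fin 3) (Fin 3) K) = a * b * c := by
  simp [Matrix.det_fin_three]
  linear_combination (a * b * c * (2 * e + 1)) * h2e

omit [Valued K ℤᵐ⁰] in
/-- `w₀ = antidiag(1,1,1)` exists in `U(σ, Φ₃)` (★ `weylLongU`). [cite: Rogawski1990, §1.10 p. 9] -/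
private theorem flickerFrame_exists_weyl (σ : K →+* K) :
    ∃ w : ↥(unitaryGroupOfForm σ ((StdForm.antidiagonal 3).over K)), ((w : GL (Fin 3) K) : Matrix (Fin 3) (Fin 3) K) = !![(0 : K), 0, 1; 0, 1, 0; 1, 0, 0] :=
  ⟨weylLongU σ rfl, coe_coe_weylLongU_three σ rfl⟩

omit [Valued K ℤᵐ⁰] in
/-- `w₀⁻¹ = w₀` on matrices. [cite: Rogawski1990, §1.10 p. 9] -/
private theorem flickerFrame_weyl_inv_eq {σ : K →+* K} (w : ↥(unitaryGroupOfForm σ ((StdForm.antidiagonal 3).over K)))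
    (hw : ((w : GL (Fin 3) K) : Matrix (Fin 3) (Fin 3) K) = !![(0 : K), 0, 1; 0, 1, 0; 1, 0, 0]) :
    (((w⁻¹ : ↥(unitaryGroupOfForm σ ((StdForm.antidiagonal 3).over K))) : GL (Fin 3) K) : Matrix (Fin 3) (Fin 3) K) = !![(0 : K), 0, 1; 0, 1, 0; 1, 0, 0] := by
  rw [Subgroup.coe_inv, Matrix.coe_units_inv, hw]
  refine Matrix.inv_eq_right_inv ?_
  ext i j
  fin_cases i <;> fin_cases j <;> simp [Matrix.mul_apply, Fin.sum_univ_three]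

omit [Valued K ℤᵐ⁰] in
/-- `g₁⁻¹ = diag(1,1,ϖ⁻¹)` on matrices. [cite: Serre1980Trees, II.1.1] -/
private theorem flickerFrame_gOne_inv_eq {ϖ : K} (hϖ0 : ϖ ≠ 0) (g₁ : GL (Fin 3) K) (hg₁ : (g₁ : Matrix (Fin 3) (Fin 3) K) = Matrix.diagonal ![(1 : K), 1, ϖ]) :
    ((g₁⁻¹ : GL (Fin 3) K) : Matrix (Fin 3) (Fin 3) K) = Matrix.diagonal ![(1 : K), 1, ϖ⁻¹] := by
  rw [Matrix.coe_units_inv, hg₁]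
  refine Matrix.inv_eq_right_inv ?_
  rw [Matrix.diagonal_mul_diagonal, ← Matrix.diagonal_one]
  congr 1
  ext i; fin_cases i <;> simp [hϖ0]

section Fix

variable [ValuativeRel K] [(Valued.v : Valuation K ℤᵐ⁰).Compatible]

/-- **FIX LETTER for `t₁`**: the root coset `1·K₀ ∈ U ⧸ K₀` is fixed by `t₁` (`t₁ ∈ K₀`). [cite: Flicker1998UnitaryFL, §2 Prop. 3 p. 78] [cite: Serre1980Trees, I.6.1] -/
theorem flickerFrame_one_mem_fixedBy {σ : K →+* K} (hvσ : ∀ x, Valued.v (σ x) = Valued.v x) {e a b c : K} (h2 : Valued.v (2 : K) = 1) (h2e : 2 * e = 1)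
    (ha : σ a * a = 1) (hb : σ b * b = 1) (hc : σ c * c = 1) (γ : ↥(unitaryGroupOfForm σ ((StdForm.antidiagonal 3).over K)))
    (hγ : ((γ : GL (Fin 3) K) : Matrix (Fin 3) (Fin 3) K) = !![e * (a + c), 0, -(e * (a - c)); 0, b, 0; -(e * (a - c)), 0, e * (a + c)]) :
    ((1 : ↥(unitaryGroupOfForm σ ((StdForm.antidiagonal 3).over K))) :
        ↥(unitaryGroupOfForm σ ((StdForm.antidiagonal 3).over K)) ⧸ (glInt 3 K).subgroupOf (unitaryGroupOfForm σ ((StdForm.antidiagonal 3).over K))) ∈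
      fixedBy (↥(unitaryGroupOfForm σ ((StdForm.antidiagonal 3).over K)) ⧸ (glInt 3 K).subgroupOf (unitaryGroupOfForm σ ((StdForm.antidiagonal 3).over K))) γ := by
  rw [mem_fixedBy_quotient_mk_iff, inv_one, one_mul, mul_one, ← unitaryInt_eq_glInt_subgroupOf]
  exact flickerFrame_one_mem_unitaryInt hvσ h2 h2e ha hb hc γ hγ

/-- **FIX LETTER for `t_ϖ`** — WHAT REPLACES `hanis`: the special coset `w₀·K₁ ∈ U ⧸ K₁` (`K₁ = U ∩ g₁ GL₃(𝒪) g₁⁻¹ = Stab_U(g₁·L₀)`, `g₁ = diag(1,1,ϖ)`; the vertex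
`w₀ g₁·L₀ = ϖ𝒪 ⊕ 𝒪 ⊕ 𝒪 = diag(ϖ,1,1)·L₀`) is fixed by `t_ϖ(a,b,c)`: `g₁⁻¹ w₀⁻¹ t_ϖ w₀ g₁ = t₁ ∈ GL₃(𝒪)` (`flickerFrame_gOne_weyl_conj_pi`).
[cite: Flicker1998UnitaryFL, §2 Prop. 3 p. 79; §3 p. 80] [cite: Serre1980Trees, II.1.1] -/
theorem flickerFrame_weyl_mem_fixedBy {σ : K →+* K} (hvσ : ∀ x, Valued.v (σ x) = Valued.v x) {ϖ e a b c : K} (h2 : Valued.v (2 : K) = 1) (h2e : 2 * e = 1)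
    (hϖ0 : ϖ ≠ 0) (ha : σ a * a = 1) (hb : σ b * b = 1) (hc : σ c * c = 1)
    (g₁ : GL (Fin 3) K) (hg₁ : (g₁ : Matrix (Fin 3) (Fin 3) K) = Matrix.diagonal ![(1 : K), 1, ϖ])
    (w : ↥(unitaryGroupOfForm σ ((StdForm.antidiagonal 3).over K))) (hw : ((w : GL (Fin 3) K) : Matrix (Fin 3) (Fin 3) K) = !![(0 : K), 0, 1; 0, 1, 0; 1, 0, 0])
    (γ : ↥(unitaryGroupOfForm σ ((StdForm.antidiagonal 3).over K)))
    (hγ : ((γ : GL (Fin 3) K) : Matrix (Fin 3) (Fin 3) K) = !![e * (a + c), 0, -(e * (a - c) * ϖ); 0, b, 0; -(e * (a - c) * ϖ⁻¹), 0, e * (a + c)]) :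
    ((w : ↥(unitaryGroupOfForm σ ((StdForm.antidiagonal 3).over K))) :
        ↥(unitaryGroupOfForm σ ((StdForm.antidiagonal 3).over K)) ⧸
          ((glInt 3 K).map (MulAut.conj g₁).toMonoidHom).subgroupOf (unitaryGroupOfForm σ ((StdForm.antidiagonal 3).over K))) ∈
      fixedBy (↥(unitaryGroupOfForm σ ((StdForm.antidiagonal 3).over K)) ⧸
        ((glInt 3 K).map (MulAut.conj g₁).toMonoidHom).subgroupOf (unitaryGroupOfForm σ ((StdForm.antidiagonal 3).over K))) γ := by
  rw [mem_fixedBy_quotient_mk_iff, Subgroup.mem_subgroupOf, mem_map_conj_glInt_iff]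
  -- the matrix of `g₁⁻¹ (w⁻¹ γ w) g₁` is `t₁`
  have hmat : ((g₁⁻¹ * ((w⁻¹ * γ * w : ↥(unitaryGroupOfForm σ ((StdForm.antidiagonal 3).over K))) : GL (Fin 3) K) * g₁ : GL (Fin 3) K) :
      Matrix (Fin 3) (Fin 3) K) = !![e * (a + c), 0, -(e * (a - c)); 0, b, 0; -(e * (a - c)), 0, e * (a + c)] := by
    rw [Units.val_mul, Units.val_mul, Subgroup.coe_mul, Subgroup.coe_mul, Units.val_mul, Units.val_mul, flickerFrame_gOne_inv_eq hϖ0 g₁ hg₁,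
      flickerFrame_weyl_inv_eq w hw, hγ, hw, hg₁, ← flickerFrame_gOne_weyl_conj_pi (e := e) (a := a) (b := b) (c := c) hϖ0]
  have hdet : Valued.v ((g₁⁻¹ * ((w⁻¹ * γ * w : ↥(unitaryGroupOfForm σ ((StdForm.antidiagonal 3).over K))) : GL (Fin 3) K) * g₁ : GL (Fin 3) K) :
      Matrix (Fin 3) (Fin 3) K).det = 1 := by
    rw [hmat, flickerFrame_det_one h2e, map_mul, map_mul, (flickerLiteral_norm_one_letters σ hvσ ha).2, (flickerLiteral_norm_one_letters σ hvσ hb).2,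
      (flickerLiteral_norm_one_letters σ hvσ hc).2, one_mul, one_mul]
  rw [mem_glInt_iff_forall_v_le_one_of_v_det_eq_one _ hdet]
  intro i j
  rw [hmat]
  exact flickerFrame_one_entries_integral hvσ h2 h2e ha hb hc i j

end Fix

end Summit.HodgeConjecture.HodgeConjecture.R90.S6

end
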